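import Summits.Ventures.PercRepro.Graph
import Summits.Ventures.PercRepro.Conditioning

/-!
# Examples: the enumeration engine's closed-form self-test cases, recomputed in Lean

The exact enumerator `percenum` (tools/USAGE.md) self-tests against closed forms; we recompute
the same closed forms from the definitions, as a calibration of `Defs`/`Graph`/`Conditioning`
against the engine's semantics:

* single edge `0 — 1` with probability `q`: `P(conn 0 1) = q`, `P(sep 0 1) = 1 - q`;
* path `0 — 1 — 2` with probabilities `p₀, p₁`: `P(conn 0 2) = p₀ p₁`
  (engine: `2/5, 3/7 ↦ 6/35`);
* triangle with probabilities `p₀₁, p₀₂, p₁₂`: `P(conn 0 1) = p₀₁ + (1 - p₀₁) p₀₂ p₁₂`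
  (engine: `1/2, 1/3, 1/4 ↦ 13/24`), proved by conditioning on the edge `{0, 1}`;
  `P(all three joined) = P(at least two edges open)` (engine: `7/24`);
  `P(all separate) = (1 - p₀₁)(1 - p₀₂)(1 - p₁₂)` (engine: `1/4`);
* the 4-cycle with all probabilities `1/2`: `P(opposite corners joined) = 1 - (1 - 1/4)² = 7/16`.
-/

namespace PercRepro

namespace Examples

open MultiGraph

/-! ### A single edge -/

/-- The graph with two vertices and one edge `0 — 1`. -/
def singleEdge : MultiGraph (Fin 2) Unit := ⟨fun _ => 0, fun _ => 1⟩

/-- On the single edge, `0 ↔ 1` iff the edge is open. -/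
theorem singleEdge_connEvent : singleEdge.connEvent 0 1 = {ω | ω () = true} := by
  ext ω
  simp only [mem_connEvent, Set.mem_setOf_eq]
  constructor
  · intro h
    cases hω : ω ()
    · have h0 : ∀ e : Unit, ω e = false := fun e => by
        cases e
        exact hω
      exact absurd (eq_of_conn_of_forall_eq_false h0 h) (by decide)
    · rfl
  · intro h
    exact Conn.of_openAdj (singleEdge.openAdj_of_open () h)

/-- Engine self-test, single edge: `P(conn 0 1) = q`. -/
theorem prob_singleEdge_conn (p : Unit → ℝ) : prob p (singleEdge.connEvent 0 1) = p () := by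
  rw [singleEdge_connEvent, prob_open]

/-- Engine self-test, single edge: `P(sep 0 1) = 1 - q`. -/
theorem prob_singleEdge_sep (p : Unit → ℝ) : prob p (singleEdge.sepEvent 0 1) = 1 - p () := by
  rw [sepEvent, prob_compl, prob_singleEdge_conn]

/-! ### The path with two edges -/

/-- The path `0 — 1 — 2`: edge `0 = {0, 1}`, edge `1 = {1, 2}`. -/
def path2 : MultiGraph (Fin 3) (Fin 2) := ⟨![0, 1], ![1, 2]⟩

/-- On the path, `0 ↔ 2` iff both edges are open. -/
theorem path2_connEvent : path2.connEvent 0 2 = {ω | ω 0 = true ∧ ω 1 = true} := by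
  ext ω
  simp only [mem_connEvent, Set.mem_setOf_eq]
  constructor
  · intro h
    refine ⟨?_, ?_⟩
    · by_contra h0
      have h0' : ω 0 = false := by simpa using h0
      have hv : ∀ e, ω e = true → path2.fst e ≠ 0 ∧ path2.snd e ≠ 0 := by
        intro e he
        fin_cases e
        · exact absurd (h0'.symm.trans he) (by decide)
        · exact ⟨by decide, by decide⟩
      exact absurd (eq_of_conn_of_isolated hv h) (by decide)
    · by_contra h1
      have h1' : ω 1 = false := by simpa using h1
      have hv : ∀ e, ω e = true → path2.fst e ≠ 2 ∧ path2.snd e ≠ 2 := by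
        intro e he
        fin_cases e
        · exact ⟨by decide, by decide⟩
        · exact absurd (h1'.symm.trans he) (by decide)
      exact absurd (eq_of_conn_of_isolated hv h.symm) (by decide)
  · rintro ⟨h0, h1⟩
    exact (Conn.of_openAdj (path2.openAdj_of_open 0 h0)).trans
      (Conn.of_openAdj (path2.openAdj_of_open 1 h1))

/-- Engine self-test, two-edge path: `P(conn 0 2) = p₀ p₁`. -/
theorem prob_path2_conn (p : Fin 2 → ℝ) : prob p (path2.connEvent 0 2) = p 0 * p 1 := by
  rw [path2_connEvent]
  have h := prob_cylinder_open p {0, 1}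
  rw [Finset.prod_pair (show (0 : Fin 2) ≠ 1 by decide)] at h
  rw [← h]
  congr 1
  ext ω
  simp

/-- Engine self-test, numerically: `2/5, 3/7 ↦ 6/35`. -/
theorem prob_path2_conn_num : prob ![2 / 5, 3 / 7] (path2.connEvent 0 2) = 6 / 35 := by
  rw [prob_path2_conn]
  norm_num

/-! ### The triangle -/

/-- The triangle: edge `0 = {0, 1}`, edge `1 = {0, 2}`, edge `2 = {1, 2}`. -/
def triangle : MultiGraph (Fin 3) (Fin 3) := ⟨![0, 0, 1], ![1, 2, 2]⟩

/-- With the edge `{0, 1}` closed, `0 ↔ 1` in the triangle iff the other two edges are open. -/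
theorem triangle_conn_of_closed {ω : Config (Fin 3)} (h0 : ω 0 = false) :
    triangle.Conn ω 0 1 ↔ ω 1 = true ∧ ω 2 = true := by
  constructor
  · intro h
    refine ⟨?_, ?_⟩
    · by_contra h1
      have h1' : ω 1 = false := by simpa using h1
      have hv : ∀ e, ω e = true → triangle.fst e ≠ 0 ∧ triangle.snd e ≠ 0 := by
        intro e he
        fin_cases e
        · exact absurd (h0.symm.trans he) (by decide)
        · exact absurd (h1'.symm.trans he) (by decide)
        · exact ⟨by decide, by decide⟩
      exact absurd (eq_of_conn_of_isolated hv h) (by decide)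
    · by_contra h2
      have h2' : ω 2 = false := by simpa using h2
      have hv : ∀ e, ω e = true → triangle.fst e ≠ 1 ∧ triangle.snd e ≠ 1 := by
        intro e he
        fin_cases e
        · exact absurd (h0.symm.trans he) (by decide)
        · exact ⟨by decide, by decide⟩
        · exact absurd (h2'.symm.trans he) (by decide)
      exact absurd (eq_of_conn_of_isolated hv h.symm) (by decide)
  · rintro ⟨h1, h2⟩
    exact (Conn.of_openAdj (triangle.openAdj_of_open 1 h1)).trans
      (Conn.of_openAdj (triangle.openAdj_of_open 2 h2)).symm

/-- Engine self-test, triangle: `P(conn 0 1) = p₀₁ + (1 - p₀₁) p₀₂ p₁₂`, by conditioning on the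
edge `{0, 1}` (`prob_split`). -/
theorem prob_triangle_conn (p : Fin 3 → ℝ) :
    prob p (triangle.connEvent 0 1) = p 0 + (1 - p 0) * (p 1 * p 2) := by
  rw [prob_split p 0]
  -- edge 0 open: the event is sure
  have hopen : prob (Function.update p 0 1) (triangle.connEvent 0 1) = 1 := by
    rw [← prob_update_one_inter_open]
    have hA : triangle.connEvent 0 1 ∩ {ω | ω 0 = true} = {ω | ω 0 = true} := by
      ext ω
      simp only [Set.mem_inter_iff, mem_connEvent, Set.mem_setOf_eq, and_iff_right_iff_imp]
      exact fun h => Conn.of_openAdj (triangle.openAdj_of_open 0 h)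
    rw [hA, prob_open, Function.update_self]
  -- edge 0 closed: the event is `{edges 1, 2 open}`
  have hclosed : prob (Function.update p 0 0) (triangle.connEvent 0 1) = p 1 * p 2 := by
    rw [← prob_update_zero_inter_closed]
    have hA : triangle.connEvent 0 1 ∩ {ω | ω 0 = false} =
        {ω | ∀ e ∈ ({1, 2} : Finset (Fin 3)), ω e = true} ∩ {ω | ω 0 = false} := by
      ext ω
      simp only [Set.mem_inter_iff, mem_connEvent, Set.mem_setOf_eq, Finset.mem_insert,
        Finset.mem_singleton, forall_eq_or_imp, forall_eq]
      constructor
      · rintro ⟨h, h0⟩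
        exact ⟨(triangle_conn_of_closed h0).1 h, h0⟩
      · rintro ⟨h, h0⟩
        exact ⟨(triangle_conn_of_closed h0).2 h, h0⟩
    rw [hA, prob_update_zero_inter_closed, prob_cylinder_open,
      Finset.prod_pair (show (1 : Fin 3) ≠ 2 by decide),
      Function.update_of_ne (show (1 : Fin 3) ≠ 0 by decide),
      Function.update_of_ne (show (2 : Fin 3) ≠ 0 by decide)]
  rw [hopen, hclosed]
  ring

/-- Engine self-test, numerically: `1/2, 1/3, 1/4 ↦ 13/24`. -/
theorem prob_triangle_conn_num :
    prob ![1 / 2, 1 / 3, 1 / 4] (triangle.connEvent 0 1) = 13 / 24 := by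
  rw [prob_triangle_conn]
  norm_num [Matrix.cons_val_two, Matrix.tail_cons, Matrix.head_cons]

/-- In the triangle, all three vertices are separate iff every edge is closed. -/
theorem triangle_allSep :
    triangle.sepEvent 0 1 ∩ triangle.sepEvent 0 2 ∩ triangle.sepEvent 1 2 =
      {ω | ∀ e ∈ (Finset.univ : Finset (Fin 3)), ω e = false} := by
  ext ω
  simp only [Set.mem_inter_iff, mem_sepEvent, Set.mem_setOf_eq, Finset.mem_univ, true_implies]
  constructor
  · rintro ⟨⟨h01, h02⟩, h12⟩ e
    cases he : ω e
    · rfl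
    · exfalso
      fin_cases e
      · exact h01 (Conn.of_openAdj (triangle.openAdj_of_open 0 he))
      · exact h02 (Conn.of_openAdj (triangle.openAdj_of_open 1 he))
      · exact h12 (Conn.of_openAdj (triangle.openAdj_of_open 2 he))
  · intro h
    refine ⟨⟨fun hc => ?_, fun hc => ?_⟩, fun hc => ?_⟩
    · exact absurd (eq_of_conn_of_forall_eq_false h hc) (by decide)
    · exact absurd (eq_of_conn_of_forall_eq_false h hc) (by decide)
    · exact absurd (eq_of_conn_of_forall_eq_false h hc) (by decide)

/-- Engine self-test, triangle: `P(all separate) = (1 - p₀₁)(1 - p₀₂)(1 - p₁₂)`. -/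
theorem prob_triangle_allSep (p : Fin 3 → ℝ) :
    prob p (triangle.sepEvent 0 1 ∩ triangle.sepEvent 0 2 ∩ triangle.sepEvent 1 2) =
      (1 - p 0) * (1 - p 1) * (1 - p 2) := by
  rw [triangle_allSep, prob_cylinder_closed, Fin.prod_univ_three]

/-- Engine self-test, numerically: `1/2, 1/3, 1/4 ↦ 1/4`. -/
theorem prob_triangle_allSep_num :
    prob ![1 / 2, 1 / 3, 1 / 4]
      (triangle.sepEvent 0 1 ∩ triangle.sepEvent 0 2 ∩ triangle.sepEvent 1 2) = 1 / 4 := by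
  rw [prob_triangle_allSep]
  norm_num [Matrix.cons_val_two, Matrix.tail_cons, Matrix.head_cons]

/-- With the edge `{0, 1}` open, `1 ↔ 2` in the triangle iff one of the other two edges is open. -/
theorem triangle_conn_one_two_of_open {ω : Config (Fin 3)} (h0 : ω 0 = true) :
    triangle.Conn ω 1 2 ↔ ω 1 = true ∨ ω 2 = true := by
  constructor
  · intro h
    by_contra hn
    have h1 : ω 1 = false := by
      cases h : ω 1
      · rfl
      · exact absurd (Or.inl h) hn
    have h2 : ω 2 = false := by
      cases h : ω 2
      · rfl
      · exact absurd (Or.inr h) hn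
    have hv : ∀ e, ω e = true → triangle.fst e ≠ 2 ∧ triangle.snd e ≠ 2 := by
      intro e he
      fin_cases e
      · exact ⟨by decide, by decide⟩
      · exact absurd (h1.symm.trans he) (by decide)
      · exact absurd (h2.symm.trans he) (by decide)
    exact absurd (eq_of_conn_of_isolated hv h.symm) (by decide)
  · rintro (h1 | h2)
    · exact (Conn.of_openAdj (triangle.openAdj_of_open 0 h0)).symm.trans
        (Conn.of_openAdj (triangle.openAdj_of_open 1 h1))
    · exact Conn.of_openAdj (triangle.openAdj_of_open 2 h2)

/-- Engine self-test, triangle: `P(all three joined) = P(at least two edges open)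
= p₀₁ p₀₂ + p₀₁ p₁₂ + p₀₂ p₁₂ - 2 p₀₁ p₀₂ p₁₂`, by conditioning on the edge `{0, 1}`. -/
theorem prob_triangle_allConn (p : Fin 3 → ℝ) :
    prob p (triangle.connEvent 0 1 ∩ triangle.connEvent 1 2) =
      p 0 * p 1 + p 0 * p 2 + p 1 * p 2 - 2 * (p 0 * p 1 * p 2) := by
  rw [prob_split p 0]
  -- edge 0 open: `1 ↔ 2` iff edge 1 or edge 2 is open
  have hopen : prob (Function.update p 0 1) (triangle.connEvent 0 1 ∩ triangle.connEvent 1 2) =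
      1 - (1 - p 1) * (1 - p 2) := by
    rw [← prob_update_one_inter_open]
    have hA : triangle.connEvent 0 1 ∩ triangle.connEvent 1 2 ∩ {ω | ω 0 = true} =
        {ω | ∀ e ∈ ({1, 2} : Finset (Fin 3)), ω e = false}ᶜ ∩ {ω | ω 0 = true} := by
      ext ω
      simp only [Set.mem_inter_iff, mem_connEvent, Set.mem_compl_iff, Set.mem_setOf_eq,
        Finset.mem_insert, Finset.mem_singleton, forall_eq_or_imp, forall_eq, not_and_or]
      constructor
      · rintro ⟨⟨_, h12⟩, h0⟩
        refine ⟨?_, h0⟩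
        rcases (triangle_conn_one_two_of_open h0).1 h12 with h | h
        · exact Or.inl (by simp [h])
        · exact Or.inr (by simp [h])
      · rintro ⟨h, h0⟩
        refine ⟨⟨Conn.of_openAdj (triangle.openAdj_of_open 0 h0), ?_⟩, h0⟩
        refine (triangle_conn_one_two_of_open h0).2 ?_
        rcases h with h | h
        · exact Or.inl (by simpa using h)
        · exact Or.inr (by simpa using h)
    rw [hA, prob_update_one_inter_open, prob_compl, prob_cylinder_closed,
      Finset.prod_pair (show (1 : Fin 3) ≠ 2 by decide),
      Function.update_of_ne (show (1 : Fin 3) ≠ 0 by decide),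
      Function.update_of_ne (show (2 : Fin 3) ≠ 0 by decide)]
  -- edge 0 closed: `0 ↔ 1` forces edges 1, 2 open, and then `1 ↔ 2` holds
  have hclosed : prob (Function.update p 0 0) (triangle.connEvent 0 1 ∩ triangle.connEvent 1 2) =
      p 1 * p 2 := by
    rw [← prob_update_zero_inter_closed]
    have hA : triangle.connEvent 0 1 ∩ triangle.connEvent 1 2 ∩ {ω | ω 0 = false} =
        {ω | ∀ e ∈ ({1, 2} : Finset (Fin 3)), ω e = true} ∩ {ω | ω 0 = false} := by
      ext ω
      simp only [Set.mem_inter_iff, mem_connEvent, Set.mem_setOf_eq, Finset.mem_insert,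
        Finset.mem_singleton, forall_eq_or_imp, forall_eq]
      constructor
      · rintro ⟨⟨h01, _⟩, h0⟩
        exact ⟨(triangle_conn_of_closed h0).1 h01, h0⟩
      · rintro ⟨⟨h1, h2⟩, h0⟩
        exact ⟨⟨(triangle_conn_of_closed h0).2 ⟨h1, h2⟩,
          Conn.of_openAdj (triangle.openAdj_of_open 2 h2)⟩, h0⟩
    rw [hA, prob_update_zero_inter_closed, prob_cylinder_open,
      Finset.prod_pair (show (1 : Fin 3) ≠ 2 by decide),
      Function.update_of_ne (show (1 : Fin 3) ≠ 0 by decide),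
      Function.update_of_ne (show (2 : Fin 3) ≠ 0 by decide)]
  rw [hopen, hclosed]
  ring

/-- Engine self-test, numerically: `1/2, 1/3, 1/4 ↦ 7/24`. -/
theorem prob_triangle_allConn_num :
    prob ![1 / 2, 1 / 3, 1 / 4] (triangle.connEvent 0 1 ∩ triangle.connEvent 1 2) = 7 / 24 := by
  rw [prob_triangle_allConn]
  norm_num [Matrix.cons_val_two, Matrix.tail_cons, Matrix.head_cons]

/-! ### The 4-cycle -/

/-- The 4-cycle `0 — 1 — 2 — 3 — 0`: edge `0 = {0, 1}`, `1 = {1, 2}`, `2 = {2, 3}`, `3 = {3, 0}`. -/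
def cycle4 : MultiGraph (Fin 4) (Fin 4) := ⟨![0, 1, 2, 3], ![1, 2, 3, 0]⟩

/-- On the 4-cycle, opposite corners `0 ↔ 2` iff one of the two paths `0 — 1 — 2`, `0 — 3 — 2`
is open. -/
theorem cycle4_connEvent :
    cycle4.connEvent 0 2 = {ω | ω 0 = true ∧ ω 1 = true} ∪ {ω | ω 2 = true ∧ ω 3 = true} := by
  ext ω
  simp only [mem_connEvent, Set.mem_union, Set.mem_setOf_eq]
  constructor
  · intro h
    by_contra hn
    have hn1 : ω 0 = true → ω 1 = false := fun h0 => by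
      cases h : ω 1
      · rfl
      · exact absurd (Or.inl ⟨h0, h⟩) hn
    have hn2 : ω 2 = true → ω 3 = false := fun h2 => by
      cases h : ω 3
      · rfl
      · exact absurd (Or.inr ⟨h2, h⟩) hn
    -- the vertex set `X` containing `0` but not `2` with no open boundary edge
    have key : ∀ X : Set (Fin 4), (0 : Fin 4) ∈ X → (2 : Fin 4) ∉ X →
        (∀ e, ω e = true → (cycle4.fst e ∈ X ↔ cycle4.snd e ∈ X)) → False :=
      fun X h0 h2 hX => h2 (mem_of_conn_of_closed_boundary hX h0 h)
    by_cases h0 : ω 0 = true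
    · have h1 : ω 1 = false := hn1 h0
      by_cases h2 : ω 2 = true
      · have h3 : ω 3 = false := hn2 h2
        -- edges 1 and 3 closed: `X = {0, 1}`
        refine key {0, 1} (by simp) (by decide) fun e he => ?_
        fin_cases e
        · simp [cycle4]
        · exact absurd (h1.symm.trans he) (by decide)
        · simp [cycle4]
        · exact absurd (h3.symm.trans he) (by decide)
      · have h2' : ω 2 = false := by simpa using h2
        -- edges 1 and 2 closed: `X = {0, 1, 3}`
        refine key {0, 1, 3} (by simp) (by decide) fun e he => ?_
        fin_cases e
        · simp [cycle4]
        · exact absurd (h1.symm.trans he) (by decide)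
        · exact absurd (h2'.symm.trans he) (by decide)
        · simp [cycle4]
    · have h0' : ω 0 = false := by simpa using h0
      by_cases h2 : ω 2 = true
      · have h3 : ω 3 = false := hn2 h2
        -- edges 0 and 3 closed: `X = {0}`
        refine key {0} (by simp) (by decide) fun e he => ?_
        fin_cases e
        · exact absurd (h0'.symm.trans he) (by decide)
        · simp [cycle4]
        · simp [cycle4]
        · exact absurd (h3.symm.trans he) (by decide)
      · have h2' : ω 2 = false := by simpa using h2
        -- edges 0 and 2 closed: `X = {0, 3}`
        refine key {0, 3} (by simp) (by decide) fun e he => ?_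
        fin_cases e
        · exact absurd (h0'.symm.trans he) (by decide)
        · simp [cycle4]
        · exact absurd (h2'.symm.trans he) (by decide)
        · simp [cycle4]
  · rintro (⟨h0, h1⟩ | ⟨h2, h3⟩)
    · exact (Conn.of_openAdj (cycle4.openAdj_of_open 0 h0)).trans
        (Conn.of_openAdj (cycle4.openAdj_of_open 1 h1))
    · exact (Conn.of_openAdj (cycle4.openAdj_of_open 3 h3)).symm.trans
        (Conn.of_openAdj (cycle4.openAdj_of_open 2 h2)).symm

/-- Engine self-test, 4-cycle: `P(conn 0 2) = p₀ p₁ + p₂ p₃ - p₀ p₁ p₂ p₃`. -/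
theorem prob_cycle4_conn (p : Fin 4 → ℝ) :
    prob p (cycle4.connEvent 0 2) = p 0 * p 1 + p 2 * p 3 - p 0 * p 1 * (p 2 * p 3) := by
  rw [cycle4_connEvent]
  have hA : {ω : Config (Fin 4) | ω 0 = true ∧ ω 1 = true} =
      {ω | ∀ e ∈ ({0, 1} : Finset (Fin 4)), ω e = true} := by
    ext ω
    simp
  have hB : {ω : Config (Fin 4) | ω 2 = true ∧ ω 3 = true} =
      {ω | ∀ e ∈ ({2, 3} : Finset (Fin 4)), ω e = true} := by
    ext ω
    simp
  have hAB : {ω : Config (Fin 4) | ∀ e ∈ ({0, 1} : Finset (Fin 4)), ω e = true} ∩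
      {ω | ∀ e ∈ ({2, 3} : Finset (Fin 4)), ω e = true} =
      {ω | ∀ e ∈ ({0, 1, 2, 3} : Finset (Fin 4)), ω e = true} := by
    ext ω
    simp only [Set.mem_inter_iff, Set.mem_setOf_eq, Finset.mem_insert, Finset.mem_singleton,
      forall_eq_or_imp, forall_eq]
    tauto
  have h := prob_union_add_inter p {ω : Config (Fin 4) | ∀ e ∈ ({0, 1} : Finset (Fin 4)), ω e = true}
    {ω | ∀ e ∈ ({2, 3} : Finset (Fin 4)), ω e = true}
  rw [hA, hB, hAB] at *
  rw [prob_cylinder_open, prob_cylinder_open, prob_cylinder_open,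
    Finset.prod_pair (show (0 : Fin 4) ≠ 1 by decide),
    Finset.prod_pair (show (2 : Fin 4) ≠ 3 by decide)] at h
  rw [Finset.prod_insert (by decide), Finset.prod_insert (by decide),
    Finset.prod_pair (show (2 : Fin 4) ≠ 3 by decide)] at h
  linarith

/-- Engine self-test, numerically: all probabilities `1/2 ↦ 7/16`. -/
theorem prob_cycle4_conn_num : prob (fun _ => (1 / 2 : ℝ)) (cycle4.connEvent 0 2) = 7 / 16 := by
  rw [prob_cycle4_conn]
  norm_num

end Examples

end PercRepro
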